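import Literature.Uncategorized.DiamondCross
import Literature.Analysis.Complex.BoundedCrossTheoremTwoStrips
import HarnessLib

/-!
# Discharge of the named fact `DiamondCross` — MOVED (deprecated alias module)

Topic `Literature/Uncategorized` (companion of `Literature/Uncategorized/DiamondCross.lean`). The
discharge `Literature.Uncategorized.DiamondCross_holds` now lives, proof byte-identical, at
`Literature.Analysis.Complex.DiamondCross_holds`
(`Literature/Analysis/Complex/BoundedCrossTheoremTwoStrips.lean`, librarian move p95259,
2026-08-16), next to the fact and to the proving theorem
`Literature.Analysis.Complex.exists_holomorphic_extension_diamond_of_separately`. This module keeps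
only a deprecated alias under the old name for its one importer
(`Summits/CriticalPhenomena/Ising3DConformalLimit/Theorems/`
`HyperoctahedralRPLimitRotationInvariantDiamondCross.lean`,
`stub_diamondCross : DiamondCross := Literature.Uncategorized.DiamondCross_holds`; re-checked:
elaborates through both aliases, deprecation warnings only).

* `Literature.Uncategorized.DiamondCross_holds` — deprecated alias of
  `Literature.Analysis.Complex.DiamondCross_holds`.
-/

namespace Literature.Uncategorized

set_option linter.deprecated false in
/-- DEPRECATED (librarian move 2026-08-16): the discharge now lives at
`Literature.Analysis.Complex.DiamondCross_holds`; this is the same proof term under the old name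
(its type `DiamondCross` is the deprecated `abbrev` of `Literature/Uncategorized/DiamondCross.lean`,
definitionally the moved fact). [folklore] -/
@[deprecated Literature.Analysis.Complex.DiamondCross_holds (since := "2026-08-16")]
theorem DiamondCross_holds : DiamondCross :=
  Literature.Analysis.Complex.DiamondCross_holds

end Literature.Uncategorized
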